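import Mathlib
import Literature.Computability.AlgebraicComplexity.SkeletonReinstantiation
import Literature.Computability.AlgebraicComplexity.StandardFamilies
import HarnessLib

/-!
# LangWeilTransfer — crux `ShatteringExclusion` (stmt-ValiantsHypothesis-6372), line `birth`:
# transcendental constants never help (the qualitative half of `stub_lowDegreeConstants`)

Route `ValiantsHypothesis/LangWeilTransfer`, crux `ShatteringExclusion`, registered line
`Cruxes/ShatteringExclusion/Lines/birth.lean`, stub `stub_lowDegreeConstants` (CONSTANT DESCENT FOR
THE PERMANENT): a near-optimal fan-in-two `ℂ`-circuit for `per_n` can be re-chosen, at polynomial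
cost, with all its constants (`slotConst`) in an intermediate field `ℚ ⊆ K ⊆ ℂ` that is finite over
`ℚ` **of degree `≤ n^{d₀}`**. The stub is open-problem grade because of the degree bound (it is the
nonuniform, permanent-specific field-descent problem for Valiant's classes, Bürgisser 2000 Ch. 4).

This file proves, unconditionally, everything in the stub EXCEPT the degree bound:

* `exists_algebraic_constants` — for ANY integer target `g` and any fan-in-two circuit `P` over
  `ℂ` with `s` gates computing (the image of) `g`, there is a fan-in-two circuit over `ℂ` with
  `3s` gates computing `g` all of whose slot constants are ALGEBRAIC over `ℚ`. Proof (Bürgisser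
  2000 TCS §5 (A3), "By the Nullstellensatz, the system `(S_n)` is also solvable over the algebraic
  closure of `ℚ`"): the constant vector of `P` is a `ℂ`-point of the circuit coefficient ideal
  `I ⊆ ℚ[Y_0..Y_{4s}]` of its integer skeleton against `g` (`aeval_slotConst_eq_zero_of_computes`),
  so `I · L[Y]` is a proper ideal for `L = ℚ̄ ∩ ℂ` (`algebraicClosure ℚ ℂ`, algebraically
  closed), hence has a zero `y ∈ L^{4s+1}` (Hilbert's Nullstellensatz, Mathlib
  `MvPolynomial.isMaximal_iff_eq_vanishingIdeal_singleton`), and the skeleton re-instantiated at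
  `y` (`exists_circuit_of_forall_mem_circuitCoeffIdeal`) and read in `ℂ` is the required circuit
  (`slotConst_map`).
* `exists_finiteDimensional_constants` — the same with the conclusion in the stub's vocabulary:
  `∃ K : IntermediateField ℚ ℂ, FiniteDimensional ℚ K ∧ ∀ v, slotConst P' v ∈ K`
  (`K = ℚ(slot constants)`, finitely many algebraic generators).
* `lowDegreeConstants_without_degree_bound` — the stub `stub_lowDegreeConstants` with the clause
  `Module.finrank ℚ K ≤ n ^ d₀` deleted holds, with `c' = c + 1`, `N = 3`.

Honest framing: the degree bound — the whole difficulty of the stub — is NOT touched; the stub,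
the crux `ShatteringExclusion`, and the route stay open, and VP ≠ VNP is not moved. What this file
settles is that the stub is EXACTLY a statement about degrees of number fields (no transcendence
enters), i.e. the calibration "stub_lowDegreeConstants = nonuniform constant elimination for `per`
down to number fields of polynomial degree" is now kernel-checked on its qualitative side.
-/

noncomputable section

open MvPolynomial

-- the summit and the problem share the name `ValiantsHypothesis` (D-0017 single-conjunct layout)
set_option linter.dupNamespace false

namespace Summit.ValiantsHypothesis.ValiantsHypothesis.Theorems.LangWeilTransfer.ShatteringExclusion

open Literature.Computability.AlgebraicComplexity
open Literature.Computability.AlgebraicComplexity.ArithCircuit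

/-- **Transcendental constants never help** (Bürgisser 2000 TCS §5 (A3); Bürgisser 2000 §4.1):
a fan-in-two circuit over `ℂ` with `s` gates computing the image of an integer polynomial `g` may
be replaced by a fan-in-two circuit over `ℂ` with `3s` gates computing the same polynomial, all of
whose slot constants (sum coefficients, constant operands, output constant) are algebraic over `ℚ`.
[cite: Burgisser2000TCS, §5 (A3) p. 85] -/
theorem exists_algebraic_constants {σ : Type*} (g : MvPolynomial σ ℤ) (P : ArithCircuit ℂ σ)
    (h2 : P.IsFanInTwo) (hP : P.Computes (map (Int.castRingHom ℂ) g)) :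
    ∃ P' : ArithCircuit ℂ σ, P'.IsFanInTwo ∧ P'.size = 3 * P.size ∧
      P'.Computes (map (Int.castRingHom ℂ) g) ∧ ∀ i : ℕ, IsAlgebraic ℚ (slotConst P' i) := by
  -- the algebraic closure of `ℚ` inside `ℂ`
  set L : IntermediateField ℚ ℂ := algebraicClosure ℚ ℂ with hL
  haveI hLac : IsAlgClosed L := (algebraicClosure.isAlgClosure ℚ ℂ).isAlgClosed
  haveI hLalg : Algebra.IsAlgebraic ℚ L := algebraicClosure.isAlgebraic ℚ ℂ
  -- the coefficient ideal of the skeleton of `P` against `g`, extended to `L[Y]`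
  set J : Ideal (MvPolynomial (Fin (4 * P.size + 1)) L) :=
    (circuitCoeffIdeal P g).map (MvPolynomial.map (algebraMap ℚ L)) with hJ
  -- it dies under `Y ↦ slotConst P` (read in `ℂ`), hence is proper
  let θ : MvPolynomial (Fin (4 * P.size + 1)) L →+* ℂ :=
    eval₂Hom (algebraMap L ℂ) fun v => slotConst P v
  have hJθ : J ≤ RingHom.ker θ := by
    rw [hJ, Ideal.map_le_iff_le_comap]
    intro f hf
    rw [Ideal.mem_comap, RingHom.mem_ker, coe_eval₂Hom, eval₂_map,
      ← IsScalarTower.algebraMap_eq ℚ L ℂ]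
    have h0 := aeval_slotConst_eq_zero_of_computes P h2 hP hf
    rwa [MvPolynomial.aeval_def] at h0
  have hJtop : J ≠ ⊤ := fun h =>
    RingHom.ker_ne_top θ (top_le_iff.1 (h ▸ hJθ))
  obtain ⟨𝔪, h𝔪, hJ𝔪⟩ := Ideal.exists_le_maximal J hJtop
  -- Nullstellensatz: `𝔪` is the ideal of a point `y ∈ L^{4s+1}`
  obtain ⟨y, hy⟩ := MvPolynomial.isMaximal_iff_eq_vanishingIdeal_singleton.1 h𝔪
  have hyI : ∀ f ∈ circuitCoeffIdeal P g, aeval y f = 0 := by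
    intro f hf
    have hfm : MvPolynomial.map (algebraMap ℚ L) f ∈ 𝔪 := hJ𝔪 (Ideal.mem_map_of_mem _ hf)
    rwa [hy, MvPolynomial.mem_vanishingIdeal_singleton_iff, MvPolynomial.aeval_map_algebraMap] at hfm
  -- the skeleton re-instantiated at `y`, read in `ℂ`
  obtain ⟨Q, hQ2, hQs, hQc⟩ := exists_circuit_of_forall_mem_circuitCoeffIdeal P g y hyI
  refine ⟨Q.map (algebraMap L ℂ), hQ2.map _, by rw [size_map, hQs], ?_, fun i => ?_⟩
  · have h := hQc.map (algebraMap L ℂ)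
    rwa [map_map, RingHom.eq_intCast' ((algebraMap L ℂ).comp (Int.castRingHom L))] at h
  · rw [slotConst_map]
    exact IntermediateField.isAlgebraic_iff.1 (Algebra.IsAlgebraic.isAlgebraic (slotConst Q i))

/-- The same in the vocabulary of the stub: the new circuit has all its slot constants in an
intermediate field `ℚ ⊆ K ⊆ ℂ` which is FINITE over `ℚ` (`K = ℚ(slot constants)`: finitely many
algebraic generators). [cite: Burgisser2000TCS, §5 (A3) p. 85] -/
theorem exists_finiteDimensional_constants {σ : Type*} (g : MvPolynomial σ ℤ)
    (P : ArithCircuit ℂ σ) (h2 : P.IsFanInTwo) (hP : P.Computes (map (Int.castRingHom ℂ) g)) :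
    ∃ P' : ArithCircuit ℂ σ, P'.IsFanInTwo ∧ P'.size = 3 * P.size ∧
      P'.Computes (map (Int.castRingHom ℂ) g) ∧
      ∃ K : IntermediateField ℚ ℂ, FiniteDimensional ℚ K ∧
        ∀ v : Fin (4 * P'.size + 1), slotConst P' v ∈ K := by
  obtain ⟨P', h1, h2', h3, halg⟩ := exists_algebraic_constants g P h2 hP
  refine ⟨P', h1, h2', h3, IntermediateField.adjoin ℚ
    (Set.range fun v : Fin (4 * P'.size + 1) => slotConst P' v), ?_, fun v => ?_⟩
  · exact IntermediateField.finiteDimensional_adjoin fun x hx => by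
      obtain ⟨v, rfl⟩ := hx
      exact (halg v).isIntegral
  · exact IntermediateField.subset_adjoin ℚ _ ⟨v, rfl⟩

/-- **`stub_lowDegreeConstants` without the degree bound.** For every `c`, with `c' = c + 1` and
`N = 3`: if `per_n` (`n ≥ 3`) has a fan-in-two `ℂ`-circuit of size `≤ n^c`, then it has one of
size `≤ n^{c'}` all of whose slot constants lie in an intermediate field `ℚ ⊆ K ⊆ ℂ` finite over
`ℚ`. (The registered stub additionally demands `finrank ℚ K ≤ n^{d₀}`; that clause is the open
constant-elimination problem and is not proved here.) [cite: Burgisser2000TCS, §5 (A3) p. 85] -/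
theorem lowDegreeConstants_without_degree_bound :
    ∀ c : ℕ, ∃ c' N : ℕ, ∀ n ≥ N,
      (∃ P : ArithCircuit ℂ (Fin n × Fin n),
          P.IsFanInTwo ∧ P.size ≤ n ^ c ∧ P.Computes (perPoly (Fin n) ℂ)) →
        ∃ P : ArithCircuit ℂ (Fin n × Fin n),
          P.IsFanInTwo ∧ P.size ≤ n ^ c' ∧ P.Computes (perPoly (Fin n) ℂ) ∧
            ∃ K : IntermediateField ℚ ℂ, FiniteDimensional ℚ K ∧
              ∀ v : Fin (4 * P.size + 1), slotConst P v ∈ K := by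
  intro c
  refine ⟨c + 1, 3, fun n hn hex => ?_⟩
  obtain ⟨P, h2, hs, hc⟩ := hex
  have hc' : P.Computes (map (Int.castRingHom ℂ) (perPoly (Fin n) ℤ)) := by
    rwa [map_perPoly]
  obtain ⟨P', h1, h2', h3, K, hK, hmem⟩ := exists_finiteDimensional_constants _ P h2 hc'
  refine ⟨P', h1, ?_, by rwa [map_perPoly] at h3, K, hK, hmem⟩
  rw [h2', pow_succ]
  calc 3 * P.size ≤ 3 * n ^ c := Nat.mul_le_mul_left 3 hs
    _ ≤ n ^ c * n := by rw [mul_comm]; exact Nat.mul_le_mul_left _ hn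

end Summit.ValiantsHypothesis.ValiantsHypothesis.Theorems.LangWeilTransfer.ShatteringExclusion

end
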